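/-
Copyright (c) 2026 the pub-hodgecm-mathlib formalisation cell (harness21).  Prover seat hodgecm-mathlib-F0P3a-p07 (g12), 2026-09-01.  Road «S3-ram» seeding wave (LEAD T11-52 (2); owner F0P3a-p06 (g15)):
organ «C-Δ LEVI VALUE (tame)» — the input `hΔ` of the (e3) CORE-ram ★ p846879.
-/
import Literature.NumberTheory.Rogawski1990.FinExplicitTransferFactorLeviStratum            -- ★ T5-Levi (inert): §1 Levi bookkeeping (`finGammaTwo_eq_of_endoEmbLocal_eq`, `eval_finCharpolyTwo_eq…`, `log_valued_eval…`), §2 one class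
import Literature.NumberTheory.Rogawski1990.DepthZeroKappaTransferLeviCoreRamified         -- ★ p846879 (F0P3a-p01): `exists_continuousMulEquiv_level_of_frame` (the level frame from END's binder `hframe`)
import Literature.NumberTheory.Rogawski1990.FinExplicitTransferFactorDeepTauTamePairs      -- ★ T5-u-TAME (F0P3a-p04): `exists_forall_finExplicitDelta_eq_hilbertSymbol_mul_of_deep`, `finWeylRatio_eq_inv_pow_of_smul_eq`, depth token
import Literature.NumberTheory.Rogawski1990.FinExplicitTransferFactorCayleyShiftRamified   -- ★ p846868 (F0P3b-p01): `hilbertSymbol_eq_of_mul_sq_eq_mul`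
import Literature.NumberTheory.Rogawski1990.FinExplicitTransferFactorConjLeft             -- ★ `finGammaTwo_conj`, `finCharpolyTwo_conj`
import Literature.NumberTheory.Rogawski1990.RamifiedPlaceNormSymbolDichotomy              -- ★ `hilbertSymbol_eq_one_iff_exists_norm_toPlace` ∕ `…neg_one_iff_not…` (the norm reading of `(·, θ)_v`)
import Literature.NumberTheory.Automorphic.UnitaryGroupInertPlaceHyperbolicBasis          -- ★ `exists_toPlace_eq_of_galAdicCompletionMap_eq` (`σ_w`-fixed ⇒ from `L⁺_v`)
import Literature.NumberTheory.Rogawski1990.LeviNearOneDeep                              -- ★ (O1) p846586: `exists_nhds_one_forall_levi_deep` (near `1`, Levi ⇒ 1-deep)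
import Literature.NumberTheory.Automorphic.QuadraticAdeleBaseChange                       -- ★ `valued_toPlace`, `valued_toPlace_le_one_iff`
import HarnessLib

/-!
# Rogawski's transfer factor on the Levi stratum at a TAME non-split place (ramified allowed): `Δ‴_v(γ₁, γ₀) = (−det H′_w, θ)_v · ‖a − 1‖`

Topic `NumberTheory/Rogawski1990`; namespace `Literature.NumberTheory.Rogawski1990`.  KERNEL MATHEMATICS ONLY: theorems, no definition, no named fact, no `sorry`, no instance, no notation.
Cell `pub/hodgecm-mathlib`, crux H413 = `stmt-HodgeConjecture-24833`; road «S3-ram» seeding wave (LEAD F0P3a-plan (g12) T11-52 (2); owner∕table F0P3a-p06 (g15)), organ **«C-Δ LEVI VALUE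
(tame)»** (seat F0P3a-p07 (g12), the (e3) holder): the `hv hμ`-free twin of ★ T5-Levi `finExplicitDelta_eq_unitModulusChar_of_levi_of_nonsplit`, discharging the socket `hΔ` of the
(e3) CORE-ram ★ `finsum_delta_mul_classOrbitalIntegral_eq_of_levi_ramified_of_orbital_eq` (p846879) with the EXPLICIT constant `ε = (y_λ, θ)_v`, `ι_w y_λ = −det H′_w`.
HONEST LABEL: HC_CM is proved only modulo the cell's 2 remaining named inputs (hLiu418 24832, h413 24833) until rung 0 closes; «S3-ram» is Literature seeding; this file
discharges nothing by itself.

THE MATHEMATICS ([Rogawski1990] §4.9 p. 55, Prop. 4.9.1; §4.3 p. 43; §14.6 p. 242).  `L` CM, `v` a finite place of `L⁺` NON-SPLIT in `L` with `|2|_w = 1` (TAME: inert or ramified),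
`H′` hermitian with END's frame `H′_w = λ·ᵗσ̄A·Φ₃·A`, `A ∈ GL₃(𝒪_w)`, `λ = −det H′_w` (★ p846344), guard `μ|_{𝕀_{L⁺}} = ω_{L∕L⁺}`.  Let `γ₁ ∈ H_v` lie on the LEVI STRATUM:
`ι_v(γ₁) = diag(d₀, u, d₂)` regular, so (torus relations) `d₂ = (σd₀)⁻¹`, `σu = u⁻¹`, and put `a := d₀⁻¹u`.
* §1 **`κ_v(γ₁, γ₀) = (y_λ, θ)_v`** at every match `γ₀ ∈ U(H′)(L⁺_v)`: all matches are conjugate (★ §2 of T5-Levi), for `γ₀ = ψ⁻¹ι(γ₁)` (`ψ` the level frame of `A`,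
  ★ `exists_continuousMulEquiv_level_of_frame`) the column `p′ = A⁻¹e₁` is a `u`-eigenvector with `H′(p′, p′) = λ·(Φ₃)₁₁ = λ`, and `κ = +1 ⟺ λ ∈ N(L_w^×) ⟺ (y_λ, θ)_v = 1`
  (★ `finKappaAt_eq_ite_of_eigenvector`, ★ `hilbertSymbol_eq_one_iff_exists_norm_toPlace`).  At an inert place of good reduction `λ = 1`: ★ T5-Levi §3 recovered.
* §2 **`(β(γ₁), θ)_v = 1` for `γ₁` 1-deep**: `χ_g(u) = −d₀u·N(a − 1)` (★ `weylNumerator_eq`), `u² + det g = u² + d₀∕σd₀`, so the symmetrised discriminant is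
  `β = N(a − 1) · c`, `c = ½·Tr(d₀·σu) ∈ 1 + 𝔪_v` — a norm times a principal unit: `(β, θ)_v = (N(a−1), θ)_v = 1` (★ `hilbertSymbol_eq_of_mul_sq_eq_mul`, ★ norm reading).
* §3 **`q_v^{−m} = ‖a − 1‖_{E_v}`** where `|χ_g(u)_w|_w = |ι_wϖ_v|_w^m`: both equal `D_v(γ₁)` (★ `finWeylRatio_eq_inv_pow_of_smul_eq`; ★ `sqrt_prod_norm_weylNumerator_cmLocal`, `‖d₀‖ = 1`).
* §4 HEAD: with ★ T5-u-TAME `Δ‴ = (β, θ)_v·q_v^{−m}·κ` for `M₀`-deep `γ₁` and the deepness of `u = u(γ_H)`, `det g = det g(γ_H)` transported along `γ₁ = yγ_Hy⁻¹`: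
  **`∃ VΔ ∈ 𝓝 1, ∀ γ_H ∈ VΔ, ∀ y d …, Δ‴_v(yγ_Hy⁻¹, γ₀) = (y_λ, θ)_v · ‖a − 1‖`** — the CORE-ram socket `hΔ` VERBATIM with `ε := (y_λ, θ)_v`.

## References
* [Rogawski1990] J. D. Rogawski, *Automorphic Representations of Unitary Groups in Three Variables*, Ann. of Math. Stud. 123 (1990), §4.9 p. 55, Prop. 4.9.1 (b); §4.3 p. 43; §14.6 p. 242.
* [LanglandsShelstad1987] R. P. Langlands, D. Shelstad, *On the definition of transfer factors*, Math. Ann. 278 (1987), §2.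
* [Omeara1963] O. T. O'Meara, *Introduction to Quadratic Forms* (1963), §63B.
-/

set_option autoImplicit false

noncomputable section

open NumberField IsDedekindDomain Filter Topology Matrix
open scoped NNReal Matrix MatrixGroups

namespace Literature.NumberTheory.Rogawski1990

open Literature.NumberTheory.Automorphic Literature.NumberTheory.Automorphic.UnitaryGroup
open Literature.NumberTheory.GaloisRepresentations Literature.NumberTheory.GaloisRepresentations.IsNonarchimedeanLocalField
open Literature.NumberTheory.QuadraticForms

/-! ## §1 `κ_v(γ₁, γ₀)` on the Levi stratum from a frame `H′_w = λ·ᵗσ̄AΦ₃A`: the constant `(y_λ, θ)_v` -/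

open scoped Classical in
/-- **THE ENDOSCOPIC SIGN ON THE LEVI STRATUM IS THE NORM CLASS OF THE FRAME SCALAR**: at a non-split place, for `H′_w = λ·ᵗσ̄A·Φ₃·A` (`λ = −det H′_w`, `A ∈ GL₃(𝒪_w)`) and
`γ₁ ∈ H_v` with `ι_v(γ₁) = diag(d)` regular, at every match `γ₀`: `κ_v(γ₁, γ₀) = 1` if `λ = σ_w z·z` for some `z ∈ L_w`, and `= −1` otherwise (eigenvector `p′ = A⁻¹e₁`,
`H′(p′, p′) = λ`; ★ `finKappaAt_eq_ite_of_eigenvector`; the proof of ★ `finKappaAt_eq_one_of_levi_of_nonsplit` with the frame of ★ `exists_continuousMulEquiv_level_of_frame`).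
[cite: Rogawski1990, §14.6 p. 242; §4.3 p. 43] [cite: LanglandsShelstad1987, §2] -/
theorem finKappaAt_eq_ite_of_levi_of_frame (L : Type) [Field L] [NumberField L] [IsCMField L]
    (H' : Matrix (Fin 3) (Fin 3) L) (hH' : (H'.map (IsCMField.complexConj L))ᵀ = H') (hH'd : IsUnit H'.det)
    {v : HeightOneSpectrum (𝓞 ↥(maximalRealSubfield L))} (w : PlacesOver L v) (hw : IsCMField.complexConj L • w.1 = w.1)
    (hH'w : IsUnit (placeForm H' w.1))
    (A : GL (Fin 3) (w.1.adicCompletion L)) (hA : A ∈ glInt 3 (w.1.adicCompletion L))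
    (hframe : placeForm H' w.1 = (-(placeForm H' w.1).det) •
      formCongr (galAdicCompletionMap (L := L) (IsCMField.complexConj L) hw) A ((StdForm.antidiagonal 3).over (w.1.adicCompletion L)))
    (γH : (cmDatum L 2 (Matrix.of fun i j : Fin 2 => if i.val + j.val + 1 = 2 then (1 : L) else 0)).Local v ×
      (cmDatum L 1 (Matrix.of fun i j : Fin 1 => if i.val + j.val + 1 = 1 then (1 : L) else 0)).Local v)
    {d : Fin 3 → (UnitaryGroup.LocalRing L v)ˣ}
    (hι : ((endoEmbLocal L v γH).val : GL (Fin 3) (UnitaryGroup.LocalRing L v)) = glDiagonal 3 (UnitaryGroup.LocalRing L v) d)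
    (hreg : ∀ i j, i ≠ j → IsUnit ((d i : UnitaryGroup.LocalRing L v) - d j)) {γ₀ : (cmDatum L 3 H').Local v}
    (h₀ : IsLocalNormPair L H' v γH γ₀) :
    finKappaAt L v H' γH γ₀ =
      if ∃ z : w.1.adicCompletion L, galAdicCompletionMap (L := L) (IsCMField.complexConj L) hw z * z = -(placeForm H' w.1).det then 1 else -1 := by
  classical
  have hc := IsCMField.complexConj_ne_one L
  haveI : Algebra.IsQuadraticExtension ↥(maximalRealSubfield L) L := IsCMField.isQuadraticExtension L
  have hvs : Subsingleton (PlacesOver L v) := PlacesOver.subsingleton_of_smul_eq (IsCMField.complexConj L) hc w hw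
  have ht := endoEmbLocal_mem_torusU_of_endoEmbLocal_eq L v γH hι
  have ha : IsUnit ((((d 0)⁻¹ * d 1 : (UnitaryGroup.LocalRing L v)ˣ) : UnitaryGroup.LocalRing L v) - 1) :=
    (HeisRing.isUnit_coe_inv_mul_sub_one_iff d 0 1).2 (hreg 1 0 (by decide))
  have hu : IsUnit ((finCharpolyTwo L v γH).eval (finGammaTwo L v γH)) := by
    rw [eval_finCharpolyTwo_eq_of_endoEmbLocal_eq L v γH hι]
    exact HeisRing.isUnit_weylNumerator (conjLocal L (IsCMField.complexConj L) v) (cmLocalForm_eq_over L 3 v) ⟨_, ht⟩ hι.symm ha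
  obtain ⟨ψ, -, hψc, hψA⟩ := exists_continuousMulEquiv_level_of_frame L H' w hw hH'w A hA hframe
  set γ₁ : (cmDatum L 3 H').Local v :=
    ψ.symm (endoEmbLocal L v γH : ↥(unitaryGroupOfForm (conjLocal L (IsCMField.complexConj L) v) (cmLocalForm L 3 v))) with hγ₁
  have hψ : ψ γ₁ = (endoEmbLocal L v γH : ↥(unitaryGroupOfForm (conjLocal L (IsCMField.complexConj L) v) (cmLocalForm L 3 v))) :=
    ψ.apply_symm_apply _
  have h₁ : IsLocalNormPair L H' v γH γ₁ := by have h := hψc γ₁; rw [hψ] at h; exact h.symm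
  obtain ⟨y, hy⟩ := isConj_iff.1 (isConj_of_isLocalNormPair_of_isLocalNormPair_of_levi L H' hH' hH'd γH hι hreg h₁ h₀)
  rw [← hy, finKappaAt_conj_right L v H' γH γ₁ y h₁]
  -- the `w`-components: `γ₁,w = A⁻¹ · diag(d_w) · A`
  have hGw : localGLPiEquiv L 3 v γ₁.val w =
      A⁻¹ * localGLPiEquiv L 3 v ((endoEmbLocal L v γH).val : GL (Fin 3) (UnitaryGroup.LocalRing L v)) w * A := by
    have h := hψA γ₁; rw [hψ] at h
    change localGLPiEquiv L 3 v ((endoEmbLocal L v γH).val : GL (Fin 3) (UnitaryGroup.LocalRing L v)) w = _ at h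
    rw [h]; group
  have htw : ∀ i j, ((localGLPiEquiv L 3 v ((endoEmbLocal L v γH).val : GL (Fin 3) (UnitaryGroup.LocalRing L v)) w :
      GL (Fin 3) (w.1.adicCompletion L)) : Matrix (Fin 3) (Fin 3) (w.1.adicCompletion L)) i j =
        (Matrix.diagonal fun k => (d k : UnitaryGroup.LocalRing L v) w) i j := by
    intro i j; rw [localGLPiEquiv_apply_apply, hι, coe_glDiagonal, Matrix.diagonal_apply, Matrix.diagonal_apply]; split_ifs <;> rfl
  have hM : ∀ i j, (γ₁.val.val : Matrix (Fin 3) (Fin 3) (UnitaryGroup.LocalRing L v)) i j w =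
      (((A⁻¹ : GL (Fin 3) (w.1.adicCompletion L)) : Matrix (Fin 3) (Fin 3) (w.1.adicCompletion L)) *
        (Matrix.diagonal fun k => (d k : UnitaryGroup.LocalRing L v) w) * (A : Matrix (Fin 3) (Fin 3) (w.1.adicCompletion L))) i j := by
    intro i j; rw [← localGLPiEquiv_apply_apply, hGw, Units.val_mul, Units.val_mul, Matrix.ext htw]
  -- the eigenvector `p′ = A⁻¹ e₁`
  letI : Unique (PlacesOver L v) := @uniqueOfSubsingleton _ hvs w
  obtain ⟨p', hp'w⟩ : ∃ p' : Fin 3 → UnitaryGroup.LocalRing L v,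
      ∀ i, p' i w = ((A⁻¹ : GL (Fin 3) (w.1.adicCompletion L)) : Matrix (Fin 3) (Fin 3) (w.1.adicCompletion L)) i 1 :=
    ⟨fun i => (RingEquiv.piUnique fun w' : PlacesOver L v => w'.1.adicCompletion L).symm
        (((A⁻¹ : GL (Fin 3) (w.1.adicCompletion L)) : Matrix (Fin 3) (Fin 3) (w.1.adicCompletion L)) i 1),
      fun i => (RingEquiv.piUnique fun w' : PlacesOver L v => w'.1.adicCompletion L).apply_symm_apply _⟩
  have hne : p' ≠ 0 := fun h0 => by
    have hcol : ∀ i, ((A⁻¹ : GL (Fin 3) (w.1.adicCompletion L)) : Matrix (Fin 3) (Fin 3) (w.1.adicCompletion L)) i 1 = 0 := fun i => by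
      rw [← hp'w i, h0, Pi.zero_apply, Pi.zero_apply]
    have h11 : ((A : Matrix (Fin 3) (Fin 3) (w.1.adicCompletion L)) *
        ((A⁻¹ : GL (Fin 3) (w.1.adicCompletion L)) : Matrix (Fin 3) (Fin 3) (w.1.adicCompletion L))) 1 1 = 1 := by
      rw [Units.mul_inv, Matrix.one_apply_eq]
    rw [Matrix.mul_apply] at h11; simp only [hcol, mul_zero, Finset.sum_const_zero] at h11; exact zero_ne_one h11
  have hp' : (γ₁.val.val : Matrix (Fin 3) (Fin 3) (UnitaryGroup.LocalRing L v)) *ᵥ p' =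
      finGammaTwo L v γH • p' := by
    funext i
    rw [LocalRing.eq_iff_apply_eq (IsCMField.complexConj L) hc w hw, finGammaTwo_eq_of_endoEmbLocal_eq L v γH hι]
    simp only [Matrix.mulVec, dotProduct, Finset.sum_apply, Pi.mul_apply, Pi.smul_apply, smul_eq_mul, hM, hp'w]
    rw [← Matrix.mul_apply]
    have hAA : (A : Matrix (Fin 3) (Fin 3) (w.1.adicCompletion L)) * ((A⁻¹ : GL (Fin 3) (w.1.adicCompletion L)) :
        Matrix (Fin 3) (Fin 3) (w.1.adicCompletion L)) = 1 := Units.mul_inv A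
    rw [Matrix.mul_assoc, hAA, Matrix.mul_one, Matrix.mul_diagonal, mul_comm]
  -- the `H′`-value of `p′` is `λ·(Φ₃)₁₁ = λ`
  have hxw : (∑ i : Fin 3, ∑ k : Fin 3, UnitaryGroup.conjLocal L (IsCMField.complexConj L) v (p' i) *
      ((UnitaryGroup.adelicForm L 3 H').map (UnitaryGroup.adeleToLocal L v)) i k * p' k) w = -(placeForm H' w.1).det := by
    simp only [Finset.sum_apply, Pi.mul_apply, conjLocal_apply_eq_galAdicCompletionMap L v w hw, localGram_apply_apply, hp'w]
    have hΦ : formCongr (galAdicCompletionMap (L := L) (IsCMField.complexConj L) hw) A⁻¹ (placeForm H' w.1) =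
        (-(placeForm H' w.1).det) • (StdForm.antidiagonal 3).over (w.1.adicCompletion L) := by
      conv_lhs => rw [hframe]
      rw [show ∀ (c : w.1.adicCompletion L) (M : Matrix (Fin 3) (Fin 3) (w.1.adicCompletion L)),
          formCongr (galAdicCompletionMap (L := L) (IsCMField.complexConj L) hw) A⁻¹ (c • M) =
            c • formCongr (galAdicCompletionMap (L := L) (IsCMField.complexConj L) hw) A⁻¹ M from fun c M => by
          simp only [formCongr, Matrix.mul_smul, Matrix.smul_mul], formCongr_inv_formCongr]
    have h11 := congrArg (fun M : Matrix (Fin 3) (Fin 3) (w.1.adicCompletion L) => M 1 1) hΦ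
    simp only [formCongr, Matrix.mul_apply, Matrix.transpose_apply, Matrix.map_apply, Matrix.smul_apply, StdForm.over_antidiagonal_apply, Finset.sum_mul,
      smul_eq_mul] at h11
    rw [Finset.sum_comm]; simpa using h11
  rw [finKappaAt_eq_ite_of_eigenvector L v H' γH γ₁ hvs h₁ hu hp' hne]
  -- the two norm conditions agree (read at the single place `w`)
  have hiff : (∃ z : UnitaryGroup.LocalRing L v, IsUnit z ∧
      (∑ i : Fin 3, ∑ k : Fin 3, UnitaryGroup.conjLocal L (IsCMField.complexConj L) v (p' i) *
        ((UnitaryGroup.adelicForm L 3 H').map (UnitaryGroup.adeleToLocal L v)) i k * p' k) =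
        z * UnitaryGroup.conjLocal L (IsCMField.complexConj L) v z) ↔
      ∃ z : w.1.adicCompletion L, galAdicCompletionMap (L := L) (IsCMField.complexConj L) hw z * z = -(placeForm H' w.1).det := by
    constructor
    · rintro ⟨z, -, hz⟩
      refine ⟨z w, ?_⟩
      have h := congr_fun hz w
      rw [hxw, Pi.mul_apply, conjLocal_apply_eq_galAdicCompletionMap L v w hw] at h
      rw [mul_comm]; exact h.symm
    · rintro ⟨z, hz⟩
      have hl0 : -(placeForm H' w.1).det ≠ 0 := (((Matrix.isUnit_iff_isUnit_det _).1 hH'w).neg).ne_zero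
      have hz0 : z ≠ 0 := fun h0 => hl0 (by rw [← hz, h0, mul_zero])
      refine ⟨(RingEquiv.piUnique fun w' : PlacesOver L v => w'.1.adicCompletion L).symm z, ?_, ?_⟩
      · exact isUnit_localRing_of_ne_zero_of_subsingleton L v hvs fun h0 => hz0 (by
          have h := congr_fun h0 w
          rwa [show ((RingEquiv.piUnique fun w' : PlacesOver L v => w'.1.adicCompletion L).symm z) w = z from
            (RingEquiv.piUnique fun w' : PlacesOver L v => w'.1.adicCompletion L).apply_symm_apply _] at h)
      · rw [LocalRing.eq_iff_apply_eq (IsCMField.complexConj L) hc w hw, hxw, Pi.mul_apply, conjLocal_apply_eq_galAdicCompletionMap L v w hw,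
          show ((RingEquiv.piUnique fun w' : PlacesOver L v => w'.1.adicCompletion L).symm z) w = z from
            (RingEquiv.piUnique fun w' : PlacesOver L v => w'.1.adicCompletion L).apply_symm_apply _, mul_comm, hz]
  exact if_congr (propext hiff ▸ Iff.rfl) rfl rfl

/-! ## §2 `(β(γ₁), θ)_v = 1` on the 1-deep Levi stratum -/

/-- **THE SYMMETRISED DISCRIMINANT IS A NORM TIMES A PRINCIPAL UNIT ON THE LEVI STRATUM, so `(β, θ)_v = 1`.**  For `ι_v(γ_H) = diag(d₀, u, d₂)` (torus relations
`σd₂·d₀ = 1`, `σu·u = 1`), `a = d₀⁻¹u` with `a − 1 ∈ E_v^×`, all `d_i` 1-deep at `w` and `|2|_w = 1`: the element `β ∈ L⁺_v^×` with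
`ι_w β = −χ_g(u)_w(u_w² + det g_w)∕(2u_w² det g_w)` (★ T5-u-TAME's `β`) satisfies `ι_w β = N(a − 1)_w · c`, `c = ½(d₀σu + σd₀·u)_w ≡ 1 (mod 𝔪_w)`, hence
`(β, θ)_v = (n, θ)_v = 1` where `ι_w n = N(a − 1)_w` (★ `hilbertSymbol_eq_of_mul_sq_eq_mul`, ★ `hilbertSymbol_eq_one_iff_exists_norm_toPlace`).
[cite: Rogawski1990, §4.9 p. 55, Prop. 4.9.1 (b)] [cite: Omeara1963, §63B] -/
theorem hilbertSymbol_symmDisc_eq_one_of_levi (L : Type) [Field L] [NumberField L] [IsCMField L]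
    {v : HeightOneSpectrum (𝓞 ↥(maximalRealSubfield L))} (w : PlacesOver L v) (hw : IsCMField.complexConj L • w.1 = w.1)
    (h2w : Valued.v (2 : w.1.adicCompletion L) = 1)
    (γH : (cmDatum L 2 (Matrix.of fun i j : Fin 2 => if i.val + j.val + 1 = 2 then (1 : L) else 0)).Local v ×
      (cmDatum L 1 (Matrix.of fun i j : Fin 1 => if i.val + j.val + 1 = 1 then (1 : L) else 0)).Local v)
    {d : Fin 3 → (UnitaryGroup.LocalRing L v)ˣ}
    (hι : ((endoEmbLocal L v γH).val : GL (Fin 3) (UnitaryGroup.LocalRing L v)) = glDiagonal 3 (UnitaryGroup.LocalRing L v) d)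
    (ha : IsUnit ((((d 0)⁻¹ * d 1 : (UnitaryGroup.LocalRing L v)ˣ) : UnitaryGroup.LocalRing L v) - 1))
    (ht1 : ∀ i : Fin 3, Valued.v ((((d i : (UnitaryGroup.LocalRing L v)ˣ) : UnitaryGroup.LocalRing L v) w) - 1) < 1)
    (β : (v.adicCompletion ↥(maximalRealSubfield L))ˣ)
    (hβ : toPlace v w (β : v.adicCompletion ↥(maximalRealSubfield L)) =
      -(((finCharpolyTwo L v γH).eval (finGammaTwo L v γH)) w *
          (finGammaTwo L v γH w ^ 2 +
            ((γH.1.val.val : Matrix (Fin 2) (Fin 2) (LocalRing L v)).map (Pi.evalRingHom (fun w' : PlacesOver L v => w'.1.adicCompletion L) w)).det)) /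
        (2 * finGammaTwo L v γH w ^ 2 *
          ((γH.1.val.val : Matrix (Fin 2) (Fin 2) (LocalRing L v)).map (Pi.evalRingHom (fun w' : PlacesOver L v => w'.1.adicCompletion L) w)).det)) :
    hilbertSymbol (v.adicCompletion ↥(maximalRealSubfield L)) (β : v.adicCompletion ↥(maximalRealSubfield L))
      (algebraMap ↥(maximalRealSubfield L) _ ((cmQuadraticGenerator L : 𝓞 ↥(maximalRealSubfield L)) : ↥(maximalRealSubfield L))) = 1 := by
  classical
  have hc := IsCMField.complexConj_ne_one L
  haveI : Algebra.IsQuadraticExtension ↥(maximalRealSubfield L) L := IsCMField.isQuadraticExtension L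
  set σ := galAdicCompletionMap (L := L) (IsCMField.complexConj L) hw with hσdef
  have ht := endoEmbLocal_mem_torusU_of_endoEmbLocal_eq L v γH hι
  obtain ⟨h20, h11, h02⟩ := HeisRing.torus_relations (conjLocal L (IsCMField.complexConj L) v) (cmLocalForm_eq_over L 3 v) ⟨_, ht⟩ hι.symm
  -- shorthand for the `w`-components
  set D0 : w.1.adicCompletion L := ((d 0 : (UnitaryGroup.LocalRing L v)ˣ) : UnitaryGroup.LocalRing L v) w with hD0
  set U : w.1.adicCompletion L := ((d 1 : (UnitaryGroup.LocalRing L v)ˣ) : UnitaryGroup.LocalRing L v) w with hU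
  set D2 : w.1.adicCompletion L := ((d 2 : (UnitaryGroup.LocalRing L v)ˣ) : UnitaryGroup.LocalRing L v) w with hD2
  have r11 : σ U * U = 1 := by
    have h := congr_fun h11 w; rwa [Pi.mul_apply, conjLocal_apply_eq_galAdicCompletionMap L v w hw, Pi.one_apply] at h
  have r02 : σ D0 * D2 = 1 := by
    have h := congr_fun h02 w; rwa [Pi.mul_apply, conjLocal_apply_eq_galAdicCompletionMap L v w hw, Pi.one_apply] at h
  have hU0 : U ≠ 0 := fun h0 => by rw [h0, mul_zero] at r11; exact zero_ne_one r11
  have hD20 : D2 ≠ 0 := fun h0 => by rw [h0, mul_zero] at r02; exact zero_ne_one r02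
  have hv1 : ∀ i : Fin 3, Valued.v (((d i : (UnitaryGroup.LocalRing L v)ˣ) : UnitaryGroup.LocalRing L v) w) = 1 := fun i => by
    have h := Valuation.map_one_add_of_lt (Valued.v : Valuation (w.1.adicCompletion L) _) (ht1 i)
    rwa [add_sub_cancel] at h
  have hD00 : D0 ≠ 0 := fun h0 => by have h := hv1 0; rw [← hD0, h0, map_zero] at h; exact zero_ne_one h
  have hσU : σ U = U⁻¹ := eq_inv_of_mul_eq_one_left r11
  have hσD0 : σ D0 = D2⁻¹ := eq_inv_of_mul_eq_one_left r02
  -- the Levi data read at `w`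
  have hinv0 : ((((d 0)⁻¹ : (UnitaryGroup.LocalRing L v)ˣ)) : UnitaryGroup.LocalRing L v) w = D0⁻¹ := by
    have h := congrFun (congrArg (fun u' : (UnitaryGroup.LocalRing L v)ˣ => (u' : UnitaryGroup.LocalRing L v)) (inv_mul_cancel (d 0))) w
    rw [Units.val_mul, Pi.mul_apply, Units.val_one, Pi.one_apply] at h
    exact eq_inv_of_mul_eq_one_left h
  have hx : ((((d 0)⁻¹ * d 1 : (UnitaryGroup.LocalRing L v)ˣ) : UnitaryGroup.LocalRing L v) - 1) w = D0⁻¹ * U - 1 := by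
    rw [Pi.sub_apply, Units.val_mul, Pi.mul_apply, hinv0, Pi.one_apply]
  have hx0 : D0⁻¹ * U - 1 ≠ 0 := by rw [← hx]; exact (Pi.isUnit_iff.1 ha w).ne_zero
  have hχw : ((finCharpolyTwo L v γH).eval (finGammaTwo L v γH)) w = (U - D0) * (U - D2) := by
    rw [eval_finCharpolyTwo_eq_of_endoEmbLocal_eq L v γH hι, Pi.mul_apply, Pi.sub_apply, Pi.sub_apply]
  have huw : finGammaTwo L v γH w = U := by rw [finGammaTwo_eq_of_endoEmbLocal_eq L v γH hι]
  have hdetw : ((γH.1.val.val : Matrix (Fin 2) (Fin 2) (LocalRing L v)).map (Pi.evalRingHom (fun w' : PlacesOver L v => w'.1.adicCompletion L) w)).det = D0 * D2 := by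
    rw [coe_fst_eq_diagonal_of_endoEmbLocal_eq L v γH hι, Matrix.det_fin_two]
    simp [Matrix.map_apply, Matrix.diagonal, hD0, hD2]
  -- `ι_w β = N(a − 1)_w · c`, `c = ½ (D0·σU + σD0·U)`
  have hβ' : toPlace v w (β : v.adicCompletion ↥(maximalRealSubfield L)) =
      (σ (D0⁻¹ * U - 1) * (D0⁻¹ * U - 1)) * ((D0 * σ U + σ D0 * U) / 2) := by
    rw [hβ, hχw, huw, hdetw, map_sub, map_one, map_mul, map_inv₀, hσU, hσD0]
    have h2 : (2 : w.1.adicCompletion L) ≠ 0 := two_ne_zero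
    field_simp
    ring
  -- `n ∈ L⁺_v` with `ι_w n = N(a − 1)_w`, and `ε′ = β∕n` with `ι_w ε′ = c`
  have hσσ : ∀ z : w.1.adicCompletion L, σ (σ z) = z := fun z => by
    haveI hvs : Subsingleton (PlacesOver L v) := PlacesOver.subsingleton_of_smul_eq (IsCMField.complexConj L) hc w hw
    letI : Unique (PlacesOver L v) := @uniqueOfSubsingleton _ hvs w
    have h := congr_fun (conjLocal_conjLocal_cm L v ((RingEquiv.piUnique fun w' : PlacesOver L v => w'.1.adicCompletion L).symm z)) w
    rwa [conjLocal_apply_eq_galAdicCompletionMap L v w hw, conjLocal_apply_eq_galAdicCompletionMap L v w hw,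
      show ((RingEquiv.piUnique fun w' : PlacesOver L v => w'.1.adicCompletion L).symm z) w = z from
        (RingEquiv.piUnique fun w' : PlacesOver L v => w'.1.adicCompletion L).apply_symm_apply _] at h
  obtain ⟨n, hn⟩ := exists_toPlace_eq_of_galAdicCompletionMap_eq (IsCMField.complexConj L) (v := v) (w := w) hc hw
    (σ (D0⁻¹ * U - 1) * (D0⁻¹ * U - 1)) (by rw [map_mul, hσσ, mul_comm])
  have hN0 : σ (D0⁻¹ * U - 1) * (D0⁻¹ * U - 1) ≠ 0 :=
    mul_ne_zero (fun h0 => hx0 (by rw [← hσσ (D0⁻¹ * U - 1), h0, map_zero])) hx0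
  have hn0 : n ≠ 0 := fun h0 => hN0 (by rw [← hn, h0, map_zero])
  -- `|c − 1|_w < 1` and `|2|_v = |4|_v = 1`
  have hc1 : Valued.v ((D0 * σ U + σ D0 * U) / 2 - 1) < 1 := by
    have hσ1 : ∀ z : w.1.adicCompletion L, Valued.v (z - 1) < 1 → Valued.v (σ z - 1) < 1 := fun z hz => by
      rw [show σ z - 1 = σ (z - 1) by rw [map_sub, map_one], hσdef, valued_galAdicCompletionMap]; exact hz
    have hmul : ∀ z z' : w.1.adicCompletion L, Valued.v (z - 1) < 1 → Valued.v (z' - 1) < 1 → Valued.v (z * z' - 1) < 1 := fun z z' hz hz' => by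
      rw [show z * z' - 1 = (z - 1) * z' + (z' - 1) by ring]
      refine lt_of_le_of_lt (Valuation.map_add _ _ _) (max_lt ?_ hz')
      rw [Valuation.map_mul]
      have h1 : Valued.v z' = 1 := by have h := Valuation.map_one_add_of_lt (Valued.v : Valuation (w.1.adicCompletion L) _) hz'; rwa [add_sub_cancel] at h
      rw [h1, mul_one]; exact hz
    have ha' := hmul _ _ (ht1 0) (hσ1 _ (ht1 1))
    have hb' := hmul _ _ (hσ1 _ (ht1 0)) (ht1 1)
    rw [show (D0 * σ U + σ D0 * U) / 2 - 1 = ((D0 * σ U - 1) + (σ D0 * U - 1)) / 2 by field_simp; ring, map_div₀, h2w, div_one]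
    exact lt_of_le_of_lt (Valuation.map_add _ _ _) (max_lt ha' hb')
  have h2v : Valued.v (2 : v.adicCompletion ↥(maximalRealSubfield L)) = 1 := by
    have h := valued_toPlace v w (2 : v.adicCompletion ↥(maximalRealSubfield L))
    rw [map_ofNat, h2w] at h
    exact (pow_eq_one_iff.1 h.symm).resolve_right (Ideal.IsDedekindDomain.ramificationIdx'_ne_zero_of_liesOver w.1.asIdeal v.ne_bot)
  have h4v : Valued.v (4 : v.adicCompletion ↥(maximalRealSubfield L)) = 1 := by
    rw [show (4 : v.adicCompletion ↥(maximalRealSubfield L)) = 2 * 2 by norm_num, map_mul, h2v, one_mul]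
  have hε : Valued.v ((β : v.adicCompletion ↥(maximalRealSubfield L)) * n⁻¹ - 1) < Valued.v (4 : v.adicCompletion ↥(maximalRealSubfield L)) := by
    rw [h4v]
    have hι : toPlace v w ((β : v.adicCompletion ↥(maximalRealSubfield L)) * n⁻¹ - 1) = (D0 * σ U + σ D0 * U) / 2 - 1 := by
      rw [map_sub, map_one, map_mul, map_inv₀, hβ', hn, mul_comm (σ (D0⁻¹ * U - 1) * (D0⁻¹ * U - 1)), mul_inv_cancel_right₀ hN0]
    have h := hc1
    rw [← hι, valued_toPlace v w] at h
    by_contra hge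
    exact absurd h (not_lt.2 (one_le_pow_of_one_le' (not_lt.1 hge) _))
  rw [hilbertSymbol_eq_of_mul_sq_eq_mul v (β := n) (β' := (β : v.adicCompletion ↥(maximalRealSubfield L))) (c := 1)
      (ε := (β : v.adicCompletion ↥(maximalRealSubfield L)) * n⁻¹) hn0 one_ne_zero (by rw [one_pow, mul_one, mul_comm, inv_mul_cancel_right₀ hn0]) hε,
    hilbertSymbol_eq_one_iff_exists_norm_toPlace L v w hw hn0]
  exact ⟨D0⁻¹ * U - 1, by rw [hn]⟩

/-! ## §3 `q_v^{−m} = ‖a − 1‖` on the Levi stratum -/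

/-- **THE DEPTH TOKEN IN MODULUS CURRENCY ON THE LEVI STRATUM: `q_v^{−m} = ‖a − 1‖_{E_v}`** when `|χ_g(u)_w|_w = |ι_wϖ_v|_w^m`, `ι_v(γ_H) = diag(d) ∈ K₃`, `a = d₀⁻¹u`:
both sides are `D_v(γ_H)` (★ `finWeylRatio_eq_inv_pow_of_smul_eq`; ★ `sqrt_prod_norm_weylNumerator_cmLocal` with `‖d₀‖ = 1`). [cite: Rogawski1990, §4.9 p. 55] -/
theorem inv_pow_eq_unitModulusChar_of_levi (L : Type) [Field L] [NumberField L] [IsCMField L]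
    {v : HeightOneSpectrum (𝓞 ↥(maximalRealSubfield L))} (w : PlacesOver L v) (hw : IsCMField.complexConj L • w.1 = w.1)
    (γH : (cmDatum L 2 (Matrix.of fun i j : Fin 2 => if i.val + j.val + 1 = 2 then (1 : L) else 0)).Local v ×
      (cmDatum L 1 (Matrix.of fun i j : Fin 1 => if i.val + j.val + 1 = 1 then (1 : L) else 0)).Local v)
    {d : Fin 3 → (UnitaryGroup.LocalRing L v)ˣ}
    (hι : ((endoEmbLocal L v γH).val : GL (Fin 3) (UnitaryGroup.LocalRing L v)) = glDiagonal 3 (UnitaryGroup.LocalRing L v) d)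
    (hint : endoEmbLocal L v γH ∈ cmLocalIntegralLevel L 3 (Matrix.of fun i j : Fin 3 => if i.val + j.val + 1 = 3 then (1 : L) else 0) v)
    (ha : IsUnit ((((d 0)⁻¹ * d 1 : (UnitaryGroup.LocalRing L v)ˣ) : UnitaryGroup.LocalRing L v) - 1)) {m : ℕ}
    (hχ : Valued.v (((finCharpolyTwo L v γH).eval (finGammaTwo L v γH)) w) =
      Valued.v ((toPlace v w (HeckeCharacter.uniformizer ↥(maximalRealSubfield L) v : v.adicCompletion ↥(maximalRealSubfield L))) ^ m)) :
    (((Nat.card (𝓞 ↥(maximalRealSubfield L) ⧸ v.asIdeal) : ℂ) ^ m))⁻¹ = (((unitModulusChar (UnitaryGroup.LocalRing L v) ha.unit : ℝ≥0) : ℝ) : ℂ) := by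
  have ht := endoEmbLocal_mem_torusU_of_endoEmbLocal_eq L v γH hι
  have hD := finWeylRatio_eq_inv_pow_of_smul_eq L v w hw γH hχ
  unfold finWeylRatio at hD
  rw [eval_finCharpolyTwo_eq_of_endoEmbLocal_eq L v γH hι, sqrt_prod_norm_weylNumerator_cmLocal L v ht hι.symm ha,
    unitModulusChar_eq_one_of_endoEmbLocal_mem L v γH hι hint 0, NNReal.coe_one, Real.sqrt_one, mul_one] at hD
  rw [hD]; push_cast; ring

/-! ## §4 HEAD: the socket `hΔ` of the (e3) CORE-ram, `ε = (y_λ, θ)_v` -/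

/-- **ROGAWSKI'S TRANSFER FACTOR ON THE LEVI STRATUM AT A TAME NON-SPLIT PLACE (RAMIFIED ALLOWED): `Δ‴_v(γ₁, γ₀) = (y_λ, θ)_v · ‖a − 1‖` NEAR `1`.**
`v` non-split with `|2|_w = 1`, `H′` hermitian non-degenerate with END's frame `H′_w = (−det H′_w)·ᵗσ̄A·Φ₃·A`, `A ∈ GL₃(𝒪_w)`, `y_λ ∈ L⁺_v` with `ι_w y_λ = −det H′_w`, guard
`μ|_{𝕀_{L⁺}} = ω_{L∕L⁺}`.  There is `VΔ ∈ 𝓝 (1 : H_v)` such that for `γ_H ∈ VΔ` and every `H_v`-conjugate `γ₁ = yγ_Hy⁻¹` on the Levi stratum (`ι_v(γ₁) = diag(d)` regular,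
`∈ K₃`, `a − 1 ∈ E_v^×`, `a = d₀⁻¹d₁`), at every match `γ₀`: `finExplicitDelta(γ₁, μ, γ₀) = (y_λ, θ)_v · ‖a − 1‖` — the socket `hΔ` of ★
`finsum_delta_mul_classOrbitalIntegral_eq_of_levi_ramified_of_orbital_eq` VERBATIM with `ε := (y_λ, θ)_v` (`= 1` when `−det H′_w ∈ N(L_w^×)`, e.g. at inert good reduction).
Assembly: ★ T5-u-TAME (`Δ‴ = (β, θ)_v·q_v^{−m}·κ` for `M₀`-deep `γ₁`, the depth of `u`, `det g` being that of `γ_H` — class functions), §2 (`(β, θ)_v = 1`, 1-deepness from ★ (O1)),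
§3 (`q_v^{−m} = ‖a − 1‖`), §1 (`κ = (y_λ, θ)_v` via ★ norm reading). [cite: Rogawski1990, §4.9 p. 55, Prop. 4.9.1 (b); §4.3 p. 43; §14.6 p. 242] [cite: LanglandsShelstad1987, §2] -/
theorem exists_nhds_one_forall_finExplicitDelta_eq_hilbertSymbol_mul_unitModulusChar_of_levi_of_frame (L : Type) [Field L] [NumberField L] [IsCMField L]
    (H' : Matrix (Fin 3) (Fin 3) L) (hH' : (H'.map (IsCMField.complexConj L))ᵀ = H') (hH'd : IsUnit H'.det)
    {v : HeightOneSpectrum (𝓞 ↥(maximalRealSubfield L))} (w : PlacesOver L v) (hw : IsCMField.complexConj L • w.1 = w.1)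
    (h2w : Valued.v (2 : w.1.adicCompletion L) = 1) (hH'w : IsUnit (placeForm H' w.1))
    (A : GL (Fin 3) (w.1.adicCompletion L)) (hA : A ∈ glInt 3 (w.1.adicCompletion L))
    (hframe : placeForm H' w.1 = (-(placeForm H' w.1).det) •
      formCongr (galAdicCompletionMap (L := L) (IsCMField.complexConj L) hw) A ((StdForm.antidiagonal 3).over (w.1.adicCompletion L)))
    (μ : HeckeCharacter L)
    (hμω : ∀ x : ideleGroup ↥(maximalRealSubfield L), μ (AdeleRing.ideleBaseChange ↥(maximalRealSubfield L) L x) = quadraticHeckeCharCM L x)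
    (yl : v.adicCompletion ↥(maximalRealSubfield L)) (hyl : toPlace v w yl = -(placeForm H' w.1).det) :
    ∃ VΔ ∈ 𝓝 (1 : ((cmDatum L 2 (Matrix.of fun i j : Fin 2 => if i.val + j.val + 1 = 2 then (1 : L) else 0)).Local v ×
        (cmDatum L 1 (Matrix.of fun i j : Fin 1 => if i.val + j.val + 1 = 1 then (1 : L) else 0)).Local v)),
      ∀ γH ∈ VΔ, ∀ (y : ((cmDatum L 2 (Matrix.of fun i j : Fin 2 => if i.val + j.val + 1 = 2 then (1 : L) else 0)).Local v ×
        (cmDatum L 1 (Matrix.of fun i j : Fin 1 => if i.val + j.val + 1 = 1 then (1 : L) else 0)).Local v)) (d : Fin 3 → (UnitaryGroup.LocalRing L v)ˣ),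
        ((endoEmbLocal L v (y * γH * y⁻¹)).val : GL (Fin 3) (UnitaryGroup.LocalRing L v)) = glDiagonal 3 (UnitaryGroup.LocalRing L v) d →
        (∀ i j, i ≠ j → IsUnit ((d i : UnitaryGroup.LocalRing L v) - d j)) →
        endoEmbLocal L v (y * γH * y⁻¹) ∈ cmLocalIntegralLevel L 3 (Matrix.of fun i j : Fin 3 => if i.val + j.val + 1 = 3 then (1 : L) else 0) v →
        ∀ (ha : IsUnit ((((d 0)⁻¹ * d 1 : (UnitaryGroup.LocalRing L v)ˣ) : UnitaryGroup.LocalRing L v) - 1)) (γ₀ : (cmDatum L 3 H').Local v),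
          IsLocalNormPair L H' v (y * γH * y⁻¹) γ₀ →
          finExplicitDelta L v H' (y * γH * y⁻¹) μ γ₀ =
            (hilbertSymbol (v.adicCompletion ↥(maximalRealSubfield L)) yl
                (algebraMap ↥(maximalRealSubfield L) _ ((cmQuadraticGenerator L : 𝓞 ↥(maximalRealSubfield L)) : ↥(maximalRealSubfield L))) : ℂ) *
              (((unitModulusChar (UnitaryGroup.LocalRing L v) ha.unit : ℝ≥0) : ℝ) : ℂ) := by
  classical
  obtain ⟨M₀, hM₁, hT5⟩ := exists_forall_finExplicitDelta_eq_hilbertSymbol_mul_of_deep L v w hw μ hμω h2w H'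
  obtain ⟨V₁, hV₁, hdeep⟩ := exists_nhds_one_forall_levi_deep L v w
  have hϖ0 : (toPlace v w (HeckeCharacter.uniformizer ↥(maximalRealSubfield L) v : v.adicCompletion ↥(maximalRealSubfield L))) ^ M₀ ≠ 0 :=
    pow_ne_zero _ (toPlace_heckeUniformizer_ne_zero L v w)
  obtain ⟨W, hW, hW1⟩ := (eventually_nhds_one_valued_sub_one_le L v w hϖ0).exists_mem
  refine ⟨V₁ ∩ W, Filter.inter_mem hV₁ hW, fun γH hγ y d hι hreg hint ha γ₀ h₀ => ?_⟩
  have hl0 : -(placeForm H' w.1).det ≠ 0 := (((Matrix.isUnit_iff_isUnit_det _).1 hH'w).neg).ne_zero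
  have hyl0 : yl ≠ 0 := fun h0 => hl0 (by rw [← hyl, h0, map_zero])
  -- deepness of `u` and `det g` along the conjugate `γ₁ = yγ_Hy⁻¹` (class functions of `γ_H`)
  have hud : Valued.v (finGammaTwo L v (y * γH * y⁻¹) w - 1) ≤
      Valued.v ((toPlace v w (HeckeCharacter.uniformizer ↥(maximalRealSubfield L) v : v.adicCompletion ↥(maximalRealSubfield L))) ^ M₀) := by
    rw [finGammaTwo_conj]; exact (hW1 γH hγ.2).1
  have hdd : Valued.v ((((y * γH * y⁻¹).1.val.val : Matrix (Fin 2) (Fin 2) (LocalRing L v)).map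
        (Pi.evalRingHom (fun w' : PlacesOver L v => w'.1.adicCompletion L) w)).det - 1) ≤
      Valued.v ((toPlace v w (HeckeCharacter.uniformizer ↥(maximalRealSubfield L) v : v.adicCompletion ↥(maximalRealSubfield L))) ^ M₀) := by
    have hdet : (((y * γH * y⁻¹).1.val.val : Matrix (Fin 2) (Fin 2) (LocalRing L v)).map
        (Pi.evalRingHom (fun w' : PlacesOver L v => w'.1.adicCompletion L) w)).det =
        ((γH.1.val.val : Matrix (Fin 2) (Fin 2) (LocalRing L v)).map (Pi.evalRingHom (fun w' : PlacesOver L v => w'.1.adicCompletion L) w)).det := by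
      have hprod : ((y * γH * y⁻¹).1.val.val : Matrix (Fin 2) (Fin 2) (LocalRing L v)) =
          (y.1.val.val : Matrix (Fin 2) (Fin 2) (LocalRing L v)) * (γH.1.val.val : Matrix (Fin 2) (Fin 2) (LocalRing L v)) *
            ((y⁻¹).1.val.val : Matrix (Fin 2) (Fin 2) (LocalRing L v)) := rfl
      have hone : ((y⁻¹).1.val.val : Matrix (Fin 2) (Fin 2) (LocalRing L v)) * (y.1.val.val : Matrix (Fin 2) (Fin 2) (LocalRing L v)) = 1 :=
        congrArg (fun g : ((cmDatum L 2 (Matrix.of fun i j : Fin 2 => if i.val + j.val + 1 = 2 then (1 : L) else 0)).Local v ×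
            (cmDatum L 1 (Matrix.of fun i j : Fin 1 => if i.val + j.val + 1 = 1 then (1 : L) else 0)).Local v) =>
          ((g.1.val.val : Matrix (Fin 2) (Fin 2) (LocalRing L v)))) (inv_mul_cancel y)
      rw [hprod, Matrix.map_mul, Matrix.map_mul, Matrix.det_mul, Matrix.det_mul, mul_comm, ← mul_assoc, ← Matrix.det_mul, ← Matrix.map_mul, hone,
        Matrix.map_one _ (map_zero _) (map_one _), Matrix.det_one, one_mul]
    rw [hdet]; exact (hW1 γH hγ.2).2
  -- the Levi data of `γ₁`
  have ht := endoEmbLocal_mem_torusU_of_endoEmbLocal_eq L v (y * γH * y⁻¹) hι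
  have hu : IsUnit ((finCharpolyTwo L v (y * γH * y⁻¹)).eval (finGammaTwo L v (y * γH * y⁻¹))) := by
    rw [eval_finCharpolyTwo_eq_of_endoEmbLocal_eq L v (y * γH * y⁻¹) hι]
    exact HeisRing.isUnit_weylNumerator (conjLocal L (IsCMField.complexConj L) v) (cmLocalForm_eq_over L 3 v) ⟨_, ht⟩ hι.symm ha
  have hχ0 : ((finCharpolyTwo L v (y * γH * y⁻¹)).eval (finGammaTwo L v (y * γH * y⁻¹))) w ≠ 0 := (Pi.isUnit_iff.1 hu w).ne_zero
  have hχ1 : Valued.v (((finCharpolyTwo L v (y * γH * y⁻¹)).eval (finGammaTwo L v (y * γH * y⁻¹))) w) ≤ 1 := by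
    rw [eval_finCharpolyTwo_eq_of_endoEmbLocal_eq L v (y * γH * y⁻¹) hι, Pi.mul_apply, Pi.sub_apply, Pi.sub_apply, Valuation.map_mul]
    have h1 := fun i => valued_apply_eq_one_of_endoEmbLocal_mem L v (y * γH * y⁻¹) hι hint i w
    refine mul_le_one' ?_ ?_ <;>
      refine le_trans (Valuation.map_sub _ _ _) (max_le ?_ ?_) <;> simp [h1]
  obtain ⟨β, hβ⟩ := exists_units_toPlace_eq_symmDisc_of_deep L v w hw h2w hM₁ (y * γH * y⁻¹) hχ0 hud hdd
  have hχ := valued_eval_eq_valued_toPlace_pow_toNat_of_toPlace_eq L v w h2w hM₁ (y * γH * y⁻¹) hud hdd hχ1 β hβ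
  rw [hT5 (y * γH * y⁻¹) _ γ₀ hχ hud hdd β hβ h₀,
    hilbertSymbol_symmDisc_eq_one_of_levi L w hw h2w (y * γH * y⁻¹) hι ha (hdeep γH hγ.1 y d hι) β hβ,
    inv_pow_eq_unitModulusChar_of_levi L w hw (y * γH * y⁻¹) hι hint ha hχ,
    finKappaAt_eq_ite_of_levi_of_frame L H' hH' hH'd w hw hH'w A hA hframe (y * γH * y⁻¹) hι hreg h₀]
  by_cases hex : ∃ z : w.1.adicCompletion L, galAdicCompletionMap (L := L) (IsCMField.complexConj L) hw z * z = -(placeForm H' w.1).det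
  · rw [if_pos hex, (hilbertSymbol_eq_one_iff_exists_norm_toPlace L v w hw hyl0).2 (by rw [hyl]; exact hex)]
    push_cast; ring
  · rw [if_neg hex, (hilbertSymbol_eq_neg_one_iff_not_exists_norm_toPlace L v w hw hyl0).2 (by rw [hyl]; exact hex)]
    push_cast; ring

end Literature.NumberTheory.Rogawski1990

end
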